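import Literature.AnabelianGeometry.EtaleTheta.ThetaProperFractionPairSmallIndex
import Literature.AnabelianGeometry.EtaleTheta.Discharge.Sec5ThetaProperHThetaSmallIndex
import Literature.AnabelianGeometry.EtaleTheta.Discharge.Sec4Prop42iiiThetaTwistTowerSmallIndex
import Literature.AnabelianGeometry.EtaleTheta.Discharge.Sec5JunctionSmallIndexHypotheses
import Literature.AnabelianGeometry.EtaleTheta.Discharge.Sec5ThetaStubLiftOfSettingPin
import Literature.AnabelianGeometry.EtaleTheta.ThetaTwistTowerThetaCoordinate
import HarnessLib

/-!
# [EtTh] §5 — the FIRST §5 DATUM AT THE CARRIER OF RECORD: the §5 data (pp.326–331 (PDF pp.100–105)) over the small-index fourth tower model at a translation-free anchor `(Compat₃′/M, 0)`, theta function / fraction-pair / `l`-th root CONSTRUCTED, BOTH divisor binders THEOREMS, and AT THE GENUINE `Π^tp_X̲̲` of a `ThetaSetting`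

S. Mochizuki, *The étale theta function and its Frobenioid-theoretic manifestations*, Publ. RIMS **45** (2009)
[MochizukiEtTh2009], §5 pp.326–331 (PDF pp.100–105) («the theta function determines an element `Θ̈ ∈ O^×(A_⊙^birat)` … `l`-th roots …
`N`-th roots … `A_N → B_N` … `σ` … `Π^tp_X ↠ Aut_D(B_N^bs)` … `(l·Δ_Θ)_{B_N}`»), Def. 4.1 p.312 (PDF p.86), Prop. 4.2 (iii) p.314
(PDF p.88), Prop. 4.3 (i) p.317 (PDF p.91), Prop. 5.2 (i) p.324 (PDF p.98); S. Mochizuki, *The geometry of Frobenioids I* (2008)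
[MochizukiFrdI2008], Thm. 5.2 p.100.  [cite: MochizukiEtTh2009, §5 p.330–331 (PDF pp.104–105)]
PAGE CONVENTION for [EtTh]: «printed N (PDF p.M)», N = M + 226.

abc-iut cell, layer L2 = [EtTh], seat abc-iut-L2-t4 (gen 10; §5 junction lineage), KEY «JUNCTION ASSEMBLY — plan/L2/SUBDAG-EtTh-JUNCTION
build-order STEP (5)» (abc-iut-L2-lead R1331 / R1339), FILE 2 = the small-index twin of FILE 1 (`Sec5FirstDatumThetaTwistTower`,
p513309) AT THE CARRIER OF RECORD `settingSmall` (abc-iut-L2-t3 p501267; `K : Type 0`, the universe at which the Setting's genuine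
`Π^tp_X̲̲` plugs in — p504077 §4).  ADDITIVE: nothing landed is edited or restated; every input is consumed BY NAME.
* §A GENERIC (any tempered arithmetic group `X` over a Type-0 field, any `T : ThetaEnvData N`, `ιX : T.PiX ≃ₜ* X.Pi`, the DISPLAYED
  continuous surjection `φ : Π^tp_X ↠ Compat₃′` (junction S2, design-only socket R1257), ANY open normal anchor `M ≤ Ker φ₃`
  (translation-free — abc-iut-L2-d2's descent condition for `Θ̈`, p509439/p512057), the §5 binder `hH : ιX(Π^tp_Ÿ) ⊆ H_⊙ = φ⁻¹(M)`
  DISPLAYED — a THEOREM at the `Ÿ`-anchor `M := φ(ιX(Π^tp_Ÿ))` (abc-iut-L2-t3 `hH_settingSmallYdd`, p504077; that specialisation =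
  the sequel file, once `ThetaProperFractionPairSmallIndexYdd`'s module is served)): **`firstDatumSmall`** := abc-iut-L2-t3's
  `ThetaFrobenioid.ofQuotientTemperoidData` (p497260) at `settingSmall R S X φ hφ ⊤ M` with, per junction item — D2 `h :=
  hypotheses_temperedFrobenioidSmall` (THEOREM, p504077) · D3 `Q` a PARAMETER (the model's `Θ̈`-coordinate stub `ThetaCoord.thetaStub l`,
  p504128, or the Setting's pin read on the model's base `ThetaSubquotient.ofSettingSubLift`, p514054) · D5 `θ := thetaProperUnitQuot`,
  `Pl := thetaProperFractionPairQuot` (CONSTRUCTED, abc-iut-L2-d2 p512057), `Rl` ANY `l`-th root (INHABITED: abc-iut-L2-t3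
  `prop42_iii_settingSmall`, p512762), `R` the nested `N`-th root DISPLAYED (junction D5's one remaining datum-binder; R1339 (R-c) =
  (b3); residual N-P42III-DOMAIN@SMALL-INDEX) · **D6a `hinvc := hinvc_thetaProper` AND D6b `hinvp := hinvp_thetaProper ⟸ hH` BOTH
  THEOREMS** (abc-iut-L2-d2 `Sec5ThetaProperHThetaSmallIndex`, p513262; abc-iut-L2-t3 `hinvp_of_hH`) · D7 constants `(K', constEmb, inj)`
  DISPLAYED ○ — LABEL «degenerate-or-absent at this countable carrier (abc-iut-L2-t11 p499346 / abc-iut-L2-lead R1155 J′); non-degenerate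
  constants = abc-iut-L2-d3's base-field hull» — never instantiated here, NOT counted · D8 **`Facts ⟸ {hH, hconst, hgc}`**.  Laws
  VERBATIM (0 new mathematics): `StrvSection`, `SgpCapSpec`, `SgpCupSpec`, `SgpCapSection`, `AutAmpleBN` UNCONDITIONAL; rfl dictionary;
  `thetaProperRootL` := THE `l`-th root chosen from p512762; Prop. 5.2 (i) FIRST form («an `l·N`-th root») kernel-witnessed BY NAME.
* §B **AT THE GENUINE `Π^tp_X̲̲` OF A `ThetaSetting`** (p504077 §4 pattern): `X := C.temperedArithmeticGroup e` (abc-iut-L2-t4,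
  p436226), `T := C.thetaEnvData μ hC hS` (abc-iut-L2-t8), `ιX := refl` — junction items S1 / D4 CONSTRUCTED; the datum ELABORATES there
  with BOTH choices of `Q`; ENTRY theorem `exists_thetaFrobenioid_ofThetaSetting`.
HONEST FRAMING: the carrier is OUR class-(b) combinatorial DESIGN tower (small index), NOT the tempered Frobenioid of a Tate curve; `φ` onto
`Compat₃′` is the design-only socket (its continuous-`φ` true shape is abc-iut-L2-t3's `settingClosureRange`, p510277/p513433 — the
closure-range twin of this file is the natural sequel), `hM`, `hH`, `R`, the constants and (§B, Setting-`Q` variant) `hker` are DISPLAYED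
as labelled; what this datum COUNTS for (Def. 5.4 / Prop. 5.5 / Thm. 5.6 / Thm. 5.7 cells) is the chair's ruling (R1072), not claimed here.
[EtTh]/[FrdI] are refereed prerequisite papers; nothing here bears on, or takes a side on, the disputed [IUTchIII] Cor. 3.12; nothing
here asserts abc proved or refuted; typed ≠ proved.
STATUS OF THE NESTED BINDER (abc-iut-L2-lead R1374 / R1381 / R1407, doc-only note added 2026-08-27; declarations unchanged): the S-anchored
NESTED root pair `(Rl, Rt : S.NthRoot Rl.root Rl.pair N)` displayed by `firstDatumSmall` is the SECOND form's shape typed in the `A_⊙`-anchored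
setting; Def. 4.1 (iii)'s «`f` fixed by `H_A`» for the pulled-back `l`-th root makes this type EMPTY at every anchor carrying a `Θ`-class
`≢ 0 (mod l)` at the root's level — the faithful `Ÿ`-anchor — (abc-iut-L2-d2, kernel witness at the fourth-model sockets
`ThetaTwistTowerTempered.isEmpty_nthRoot_nested_theta`, p518033; correction (C2): inhabitation stays OPEN at `V_j`-type design anchors), so
this file is a correct-but-vacuous SOCKET in `Rt` there and is NOT the R1072 count; the count is this seat's FIRST-FORM file
`Discharge/Sec5FirstDatumFirstFormSmallIndexYdd` (one `l·N`-th root, no root binder), and `nonempty_thetaRootL_mul` below is exactly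
print's Prop. 5.2 (i) FIRST form kernel-witnessed at the carrier of record.
-/

noncomputable section

namespace Literature.AnabelianGeometry.EtaleTheta

open CategoryTheory Opposite Function Literature.AlgebraicGeometry.Frobenioids Literature.AlgebraicGeometry.Frobenioids.QuasiTemperoid
  Literature.AnabelianGeometry.SemiGraphs Literature.AnabelianGeometry.SemiGraphs.GaloisObjects LogDivisorModel
  LogDivisorModel.GaloisAction LogDivisorTower TateTowerKummerTwistRShear LogDivisorModel.TateTowerThetaTwist

namespace ThetaTwistTowerSmallIndex

open ThetaTwistTowerTempered

/-! ## §A The §5 datum at `settingSmall … M`, `M ≤ Ker φ₃` (junction items D1–D8), generic `X : TemperedArithmeticGroup.{0} K` -/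

section Generic

variable (R S : ((ConnectedPart (BTemp (Compat 3 thetaShear)))ᵒᵖ ⥤ CommMonCat.{0}) → Prop)
  {K : Type} [Field K] (X : SemiGraphs.TemperedArithmeticGroup.{0} K) (φ : X.Pi →ₜ* Compat 3 thetaShear)
  (hφ : Function.Surjective φ) (M : OpenNormalSubgroup (Compat 3 thetaShear)) (hM : ∀ g ∈ M.toSubgroup, φ₃ g = 1)

/-- **The type of `l`-th roots `(A_l, B_l, s′_l, s″_l)` of the theta function's fraction-pair `(Θ̈; s′, s″)`** in `settingSmall … M`
(a reducible type abbreviation: it is elaborated ONCE, so that the root-typed binders below stay cheap — see the ELABORATION NOTE).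
[cite: MochizukiEtTh2009, §5 p.330 (PDF p.104); Prop 4.2 (iii) p.314 (PDF p.88)] -/
abbrev ThetaRootL (lv : ℕ+)
    (pullFrac : ∀ {A A' : (settingSmall R S X φ hφ (fun _ _ _ => True) M).C} (_ : A' ⟶ A),
      (settingSmall R S X φ hφ (fun _ _ _ => True) M).biratUnits A → (settingSmall R S X φ hφ (fun _ _ _ => True) M).biratUnits A') :=
  (settingSmall R S X φ hφ (fun _ _ _ => True) M).NthRoot (thetaProperUnitQuot R S M hM)
    (thetaProperFractionPairQuot R S X (fun _ _ _ => True) φ hφ M hM) lv pullFrac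

variable {lv N : ℕ+} (T : ThetaEnvData.{0} N) (ιX : T.PiX ≃ₜ* X.Pi)
  (hH : ∀ y : T.PiX, y ∈ T.PiYdd → ιX y ∈ (settingSmall R S X φ hφ (fun _ _ _ => True) M).Hodot)
  (Q : FrobenioidTheta.ThetaSubquotientStub.{0} (ConnectedPart (BTemp (Compat 3 thetaShear))))
  {pullFrac : ∀ {A A' : (settingSmall R S X φ hφ (fun _ _ _ => True) M).C} (_ : A' ⟶ A),
    (settingSmall R S X φ hφ (fun _ _ _ => True) M).biratUnits A → (settingSmall R S X φ hφ (fun _ _ _ => True) M).biratUnits A'}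
  (Rl : ThetaRootL R S X φ hφ M hM lv pullFrac)
  (Rt : (settingSmall R S X φ hφ (fun _ _ _ => True) M).NthRoot Rl.root Rl.pair N pullFrac)
  (odd_l : Odd (lv : ℕ)) (K' : Type) [Field K'] (constEmb : K'ˣ →* (temperedFrobenioidSmall R S).biratUnitsModel Rt.BN)
  (constEmb_injective : Injective constEmb)

-- ELABORATION NOTE (measured on the farm, cf. FILE 1 `Sec5FirstDatumThetaTwistTower` §3): at the small-index carrier every defeq between
-- abc-iut-L2-t3's `settingSmall … M` (a `def` chain `mkOfQuotientTemperoidQuot → mkOfQuotientTemperoid → mkOfModelCanonical`) and the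
-- generic constructor's binders unfolds the tower's level function (`lvlC`, `sInf`, …) ≈ 8·10⁴ times; the assembly below therefore (i)
-- passes every implicit argument of `ofQuotientTemperoidData` explicitly, (ii) needs `maxHeartbeats 800000` on the FOUR declarations so
-- marked (the `def`, `facts_…`, the chosen root, its `l·N` twin — each meets the generic binders once), and (iii) proves the laws by
-- first-order matching against the unfolded `def` (underscore form), which stays within the default budget; the root type is the
-- reducible abbreviation `ThetaRootL` (elaborated once) for the same reason.
set_option maxHeartbeats 800000 in
/-- **THE FIRST §5 DATUM AT THE CARRIER OF RECORD** — the [EtTh] §5 data (pp.330–331 (PDF pp.104–105)) over `B^temp(Compat₃′)⁰` at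
the small-index fourth tower model, translation-free anchor `A_⊙ = (Compat₃′/M, 0)`: `Θ̈ = thetaProperUnitQuot`, fraction-pair
`thetaProperFractionPairQuot`, an `l`-th root `Rl` and a nested `N`-th root `Rt`, `σ = s^trv_N` CONSTRUCTED, `Π^tp_X ↠ Aut_D(B_N^bs)`
from `φ`, `(l·Δ_Θ)_{(-)} := Q`; BOTH divisor binders THEOREMS (`hinvc_thetaProper`, `hinvp_thetaProper ⟸ hH`).
DISPLAYED: `φ` onto, `hM`, `hH`, `Rt`, the constants ○ (LABEL: degenerate-or-absent at this countable carrier — not counted).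
[cite: MochizukiEtTh2009, §5 p.330–331 (PDF pp.104–105)] -/
def firstDatumSmall :
    ThetaFrobenioid.{0} (settingSmall R S X φ hφ (fun _ _ _ => True) M).C (ConnectedPart (BTemp (Compat 3 thetaShear))) :=
  ThetaFrobenioid.ofQuotientTemperoidData (X := X) (hG := isTempered_compat₃') (φ := φ) (hφ := hφ)
    (tf := temperedFrobenioidSmall R S) (hZ := rfl) (hP := hPSmall R S) (NH := fun _ _ _ => True)
    (A₀ := (temperedFrobenioidSmall R S).quotConnZeroObj isTempered_compat₃' M)
    (hA₀ := (temperedFrobenioidSmall R S).isFrobeniusTrivial_quotConnZeroObj isTempered_compat₃' M)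
    (hA₀' := (temperedFrobenioidSmall R S).isGaloisObj_quotConnZeroObj_base isTempered_compat₃' M)
    (pullFrac := pullFrac) (T := T) (Rl := Rl) (R := Rt)
    (hypotheses_temperedFrobenioidSmall R S) Q odd_l ιX K' constEmb
    constEmb_injective (hinvc_thetaProper R S X (fun _ _ _ => True) φ hφ M hM Rl Rt)
    (hinvp_thetaProper R S X (fun _ _ _ => True) φ hφ M hM ιX hH Rl Rt)

/-- The tempered group `Π^tp_X` of the datum is that of the §2 datum `T`. [cite: MochizukiEtTh2009, §5 p.331 (PDF p.105)] -/
theorem firstDatumSmall_PiX : (firstDatumSmall R S X φ hφ M hM T ιX hH Q Rl Rt odd_l K' constEmb constEmb_injective).PiX = T.PiX :=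
  rfl

/-- `A_⊙` of the datum is `(Compat₃′/M, 0)`. [cite: MochizukiEtTh2009, §5 p.330 (PDF p.104)] -/
theorem firstDatumSmall_Acirc : (firstDatumSmall R S X φ hφ M hM T ιX hH Q Rl Rt odd_l K' constEmb constEmb_injective).Acirc =
    (temperedFrobenioidSmall R S).quotConnZeroObj isTempered_compat₃' M := rfl

/-- `Θ̈` of the datum is abc-iut-L2-d2's theta function `thetaProperUnitQuot ∈ O^×(A_⊙^birat)`. [cite: MochizukiEtTh2009, §5 p.330 (PDF p.104)] -/
theorem firstDatumSmall_thetaFn : (firstDatumSmall R S X φ hφ M hM T ιX hH Q Rl Rt odd_l K' constEmb constEmb_injective).thetaFn =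
    thetaProperUnitQuot R S M hM := rfl

/-- `A_N`, `B_N`, `s^⊓_N`, `s^⊔_N` of the datum are the nested root's. [cite: MochizukiEtTh2009, §5 p.330 (PDF p.104)] -/
theorem firstDatumSmall_AN_BN_sCap_sCup :
    (firstDatumSmall R S X φ hφ M hM T ιX hH Q Rl Rt odd_l K' constEmb constEmb_injective).AN = Rt.AN ∧
    (firstDatumSmall R S X φ hφ M hM T ιX hH Q Rl Rt odd_l K' constEmb constEmb_injective).BN = Rt.BN ∧
    (firstDatumSmall R S X φ hφ M hM T ιX hH Q Rl Rt odd_l K' constEmb constEmb_injective).sCap = Rt.pair.num ∧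
    (firstDatumSmall R S X φ hφ M hM T ιX hH Q Rl Rt odd_l K' constEmb constEmb_injective).sCup = Rt.pair.den :=
  ⟨rfl, rfl, rfl, rfl⟩

/-- `(l·Δ_Θ)_E` of the datum is the supplied stub `Q` at every connected covering `E`. [cite: MochizukiEtTh2009, §5 p.327 (PDF p.101)] -/
theorem firstDatumSmall_lDelta (E : ConnectedPart (BTemp (Compat 3 thetaShear))) :
    (firstDatumSmall R S X φ hφ M hM T ιX hH Q Rl Rt odd_l K' constEmb constEmb_injective).lDelta E = Q.lDelta E := rfl

/-- `l`, `N`, `K` of the datum are `lv`, `N`, `K'`. [cite: MochizukiEtTh2009, §5 p.326 (PDF p.100)] -/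
theorem firstDatumSmall_l_N_K : (firstDatumSmall R S X φ hφ M hM T ιX hH Q Rl Rt odd_l K' constEmb constEmb_injective).l = lv ∧
    (firstDatumSmall R S X φ hφ M hM T ιX hH Q Rl Rt odd_l K' constEmb constEmb_injective).N = N ∧
    (firstDatumSmall R S X φ hφ M hM T ιX hH Q Rl Rt odd_l K' constEmb constEmb_injective).K = K' := ⟨rfl, rfl, rfl⟩

/-- `s^trv_N` of the datum is the CONSTRUCTED section ([FrdI] Prop. 5.6). [cite: MochizukiEtTh2009, §5 p.331 (PDF p.105)] -/
theorem firstDatumSmall_strv : (firstDatumSmall R S X φ hφ M hM T ιX hH Q Rl Rt odd_l K' constEmb constEmb_injective).strv =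
    ThetaFrobenioid.strvOfBiKummerData (hypotheses_temperedFrobenioidSmall R S) Rt := rfl

set_option maxHeartbeats 400000 in
/-- **`StrvSection` holds UNCONDITIONALLY** at the datum. [cite: MochizukiEtTh2009, §5 p.331 (PDF p.105)] -/
theorem strvSection_firstDatumSmall :
    (firstDatumSmall R S X φ hφ M hM T ιX hH Q Rl Rt odd_l K' constEmb constEmb_injective).StrvSection :=
  ThetaFrobenioid.strvSection_ofQuotientTemperoidData _ _ _ _ _ _ _ _ _ _

set_option maxHeartbeats 400000 in
/-- **`SgpCapSpec` holds** at the datum. [cite: MochizukiEtTh2009, §5 p.331 (PDF p.105)] -/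
theorem sgpCapSpec_firstDatumSmall :
    (firstDatumSmall R S X φ hφ M hM T ιX hH Q Rl Rt odd_l K' constEmb constEmb_injective).SgpCapSpec :=
  ThetaFrobenioid.sgpCapSpec_ofQuotientTemperoidData _ _ _ _ _ _ _ _ _ _

set_option maxHeartbeats 400000 in
/-- **`SgpCupSpec` holds** at the datum. [cite: MochizukiEtTh2009, §5 p.331 (PDF p.105)] -/
theorem sgpCupSpec_firstDatumSmall :
    (firstDatumSmall R S X φ hφ M hM T ιX hH Q Rl Rt odd_l K' constEmb constEmb_injective).SgpCupSpec :=
  ThetaFrobenioid.sgpCupSpec_ofQuotientTemperoidData _ _ _ _ _ _ _ _ _ _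

set_option maxHeartbeats 400000 in
/-- **`SgpCapSection` holds** at the datum. [cite: MochizukiEtTh2009, §5 p.331 (PDF p.105)] -/
theorem sgpCapSection_firstDatumSmall :
    (firstDatumSmall R S X φ hφ M hM T ιX hH Q Rl Rt odd_l K' constEmb constEmb_injective).SgpCapSection :=
  ThetaFrobenioid.sgpCapSection_ofQuotientTemperoidData _ _ _ _ _ _ _ _ _ _

set_option maxHeartbeats 400000 in
/-- **`B_N` is Aut-ample** at the datum (p.330 (PDF p.104)). [cite: MochizukiEtTh2009, §5 p.330 (PDF p.104)] -/
theorem autAmpleBN_firstDatumSmall :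
    (firstDatumSmall R S X φ hφ M hM T ιX hH Q Rl Rt odd_l K' constEmb constEmb_injective).AutAmpleBN :=
  ThetaFrobenioid.autAmpleBN_ofQuotientTemperoidData _ _ _ _ _ _ _ _ _ _

set_option maxHeartbeats 800000 in -- the `hconst` binder reads `Rt.BN : (settingSmall …).C` in `tf.category` (ELABORATION NOTE)
/-- **`Facts` at the datum ⟸ {`hH`, `hconst` (Def. 3.6 (iii)), `hgc` (Lemma 5.8's geometric connectedness)}** — every other §5 named input a
THEOREM here (`𝔉 = firstDatumSmall …` abbreviates the `hgc` binder, abc-iut-L2-t9's pattern). [cite: MochizukiEtTh2009, §5 p.330–331 (PDF pp.104–105)] -/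
theorem facts_firstDatumSmall
    (hconst : ∀ (e : Aut Rt.BN) (k : K'ˣ), (temperedFrobenioidSmall R S).biratAutModel Rt.BN e (constEmb k) = constEmb k)
    {𝔉 : ThetaFrobenioid.{0} (settingSmall R S X φ hφ (fun _ _ _ => True) M).C (ConnectedPart (BTemp (Compat 3 thetaShear)))}
    (h𝔉 : 𝔉 = firstDatumSmall R S X φ hφ M hM T ιX hH Q Rl Rt odd_l K' constEmb constEmb_injective)
    (hgc : ∀ u : 𝔉.units 𝔉.BN, (∀ y ∈ 𝔉.imPiY, 𝔉.sgpCap y * (u : Aut 𝔉.BN) * (𝔉.sgpCap y)⁻¹ = u) →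
      𝔉.unitsToBirat 𝔉.BN u ∈ 𝔉.constEmb.range) :
    𝔉.Facts := by
  subst h𝔉
  exact ThetaFrobenioid.facts_ofQuotientTemperoidData _ _ _ _ _ _ _ _ _ _ hH hconst hgc

/-! ### The chosen `l`-th root of `(Θ̈; s′, s″)` at the carrier of record -/

variable (l : ℕ+)

set_option maxHeartbeats 800000 in -- `Classical.choice` from Prop. 4.2 (iii) at the `def`-chain setting (ELABORATION NOTE)
/-- **THE `l`-th root `(A_l, B_l, s′_l, s″_l)` of the theta function's fraction-pair at the carrier of record** — chosen
(`Classical.choice`) from abc-iut-L2-t3's Prop. 4.2 (iii) instance `prop42_iii_settingSmall` (p512762), `pullFrac := pullFracModel`;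
`firstDatumSmall … (thetaProperRootL …) Rr …` is then the datum OF RECORD for any nested `N`-th root `Rr` of it (by application).
[cite: MochizukiEtTh2009, §5 p.330 (PDF p.104); Prop 4.2 (iii) p.314 (PDF p.88)] -/
def thetaProperRootL : ThetaRootL R S X φ hφ M hM l (fun {_} {_} ψ x => (temperedFrobenioidSmall R S).pullFracModel ψ x) :=
  (prop42_iii_settingSmall R S X φ hφ M _ (thetaProperFractionPairQuot R S X (fun _ _ _ => True) φ hφ M hM) l).some

set_option maxHeartbeats 800000 in -- as for `thetaProperRootL`
/-- **Prop. 5.2 (i), FIRST form, kernel-witnessed at the carrier of record**: «an `l·N`-th root of a right fraction-pair of `Θ̈`» EXISTS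
(abc-iut-L2-t3's instance at `N := l·N`); the NESTED `N`-th root of the `l`-th root stays displayed (Rmk. 4.3.2 «compatible choice»).
[cite: MochizukiEtTh2009, Prop 5.2 (i) p.324 (PDF p.98)] -/
theorem nonempty_thetaRootL_mul :
    Nonempty (ThetaRootL R S X φ hφ M hM (l * N) (fun {_} {_} ψ x => (temperedFrobenioidSmall R S).pullFracModel ψ x)) :=
  prop42_iii_settingSmall R S X φ hφ M _ _ (l * N)

end Generic

/-! ## §B AT THE GENUINE `Π^tp_X̲̲` of a `ThetaSetting` (junction items S1 / D4 CONSTRUCTED) -/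

section OfThetaSetting

variable (R S : ((ConnectedPart (BTemp (Compat 3 thetaShear)))ᵒᵖ ⥤ CommMonCat.{0}) → Prop)
  {p : ℕ} [Fact p.Prime] {D : ThetaSetting p} {Eθ : D.EtaleThetaData} {l : ℕ} (C : Eθ.DoubleUnderline l)
  (e : D.toTemperedCurve.GroupLevelData) {lv N : ℕ+} (μ : D.CyclotomeMod l N) (hC : D.Compat) (hS : D.Sec2Hyps)
  (φ : (C.temperedArithmeticGroup e).Pi →ₜ* Compat 3 thetaShear) (hφ : Function.Surjective φ)
  (M : OpenNormalSubgroup (Compat 3 thetaShear)) (hM : ∀ g ∈ M.toSubgroup, φ₃ g = 1)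
  (ιX : (C.thetaEnvData μ hC hS).PiX ≃ₜ* (C.temperedArithmeticGroup e).Pi)
  (hH : ∀ y : (C.thetaEnvData μ hC hS).PiX, y ∈ (C.thetaEnvData μ hC hS).PiYdd →
    ιX y ∈ (settingSmall R S (C.temperedArithmeticGroup e) φ hφ (fun _ _ _ => True) M).Hodot)
  {pullFrac : ∀ {A A' : (settingSmall R S (C.temperedArithmeticGroup e) φ hφ (fun _ _ _ => True) M).C} (_ : A' ⟶ A),
    (settingSmall R S (C.temperedArithmeticGroup e) φ hφ (fun _ _ _ => True) M).biratUnits A →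
      (settingSmall R S (C.temperedArithmeticGroup e) φ hφ (fun _ _ _ => True) M).biratUnits A'}
  (Rl : ThetaRootL R S (C.temperedArithmeticGroup e) φ hφ M hM lv pullFrac)
  (Rt : (settingSmall R S (C.temperedArithmeticGroup e) φ hφ (fun _ _ _ => True) M).NthRoot Rl.root Rl.pair N pullFrac)
  (odd_l : Odd (lv : ℕ)) (K' : Type) [Field K'] (constEmb : K'ˣ →* (temperedFrobenioidSmall R S).biratUnitsModel Rt.BN)
  (constEmb_injective : Injective constEmb)

/-- **THE FIRST §5 DATUM AT THE GENUINE `Π^tp_X̲̲ = C.Huu` OF A `ThetaSetting`, with the model's `Θ̈`-coordinate stub as `(l·Δ_Θ)_{(-)}`**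
(abc-iut-L2-t4's `X := C.temperedArithmeticGroup e`, abc-iut-L2-t8's `T := C.thetaEnvData μ hC hS`, ANY identification `ιX` — `refl` in
the entry theorem below; `hH` on the Setting's own `Π^tp_Ÿ̲̲`): `StrvSection ∧ SgpCapSpec ∧ SgpCupSpec ∧ SgpCapSection ∧ AutAmpleBN`,
NO hypothesis beyond the displayed data. [cite: MochizukiEtTh2009, §5 p.322 (PDF p.96); p.330–331 (PDF pp.104–105)] -/
theorem laws_firstDatumSmall_ofThetaSetting_thetaStub :
    (firstDatumSmall R S (C.temperedArithmeticGroup e) φ hφ M hM (C.thetaEnvData μ hC hS) ιX hH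
        (ThetaCoord.thetaStub (lv : ℕ)) Rl Rt odd_l K' constEmb constEmb_injective).StrvSection ∧
    (firstDatumSmall R S (C.temperedArithmeticGroup e) φ hφ M hM (C.thetaEnvData μ hC hS) ιX hH
        (ThetaCoord.thetaStub (lv : ℕ)) Rl Rt odd_l K' constEmb constEmb_injective).SgpCapSpec ∧
    (firstDatumSmall R S (C.temperedArithmeticGroup e) φ hφ M hM (C.thetaEnvData μ hC hS) ιX hH
        (ThetaCoord.thetaStub (lv : ℕ)) Rl Rt odd_l K' constEmb constEmb_injective).SgpCupSpec ∧
    (firstDatumSmall R S (C.temperedArithmeticGroup e) φ hφ M hM (C.thetaEnvData μ hC hS) ιX hH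
        (ThetaCoord.thetaStub (lv : ℕ)) Rl Rt odd_l K' constEmb constEmb_injective).SgpCapSection ∧
    (firstDatumSmall R S (C.temperedArithmeticGroup e) φ hφ M hM (C.thetaEnvData μ hC hS) ιX hH
        (ThetaCoord.thetaStub (lv : ℕ)) Rl Rt odd_l K' constEmb constEmb_injective).AutAmpleBN :=
  ⟨strvSection_firstDatumSmall R S _ φ hφ M hM _ ιX hH _ Rl Rt odd_l K' constEmb constEmb_injective,
    sgpCapSpec_firstDatumSmall R S _ φ hφ M hM _ ιX hH _ Rl Rt odd_l K' constEmb constEmb_injective,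
    sgpCupSpec_firstDatumSmall R S _ φ hφ M hM _ ιX hH _ Rl Rt odd_l K' constEmb constEmb_injective,
    sgpCapSection_firstDatumSmall R S _ φ hφ M hM _ ιX hH _ Rl Rt odd_l K' constEmb constEmb_injective,
    autAmpleBN_firstDatumSmall R S _ φ hφ M hM _ ιX hH _ Rl Rt odd_l K' constEmb constEmb_injective⟩

variable (hker : φ.toMonoidHom.ker ≤ (ThetaSubquotient.qSub D C.Huu).ker)

/-- **… and with the Setting's OWN theta subquotients `(l·Δ_Θ)_{(-)}` read on the model's base** (`Q := ofSettingSubLift D l Π^tp_X̲̲ φ`,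
p514054; DISPLAYED clause `hker : Ker φ ≤ Ker toTheta|_{Π^tp_X̲̲}`): e.g. `StrvSection` (the other four laws likewise, by §A).
[cite: MochizukiEtTh2009, §5 p.327 (PDF p.101); p.331 (PDF p.105)] -/
theorem strvSection_firstDatumSmall_ofThetaSetting_ofSettingSubLift :
    (firstDatumSmall R S (C.temperedArithmeticGroup e) φ hφ M hM (C.thetaEnvData μ hC hS) ιX hH
        (ThetaSubquotient.ofSettingSubLift D (lv : ℕ) C.Huu φ.toMonoidHom hφ hker) Rl Rt odd_l K' constEmb
        constEmb_injective).StrvSection :=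
  strvSection_firstDatumSmall R S _ φ hφ M hM _ ιX hH _ Rl Rt odd_l K' constEmb constEmb_injective

include hH odd_l constEmb_injective in
/-- **ENTRY THEOREM — at the GENUINE tempered fundamental group `Π^tp_X̲̲` of a `ThetaSetting`: for every continuous surjection
`φ : Π^tp_X̲̲ ↠ Compat₃′`, every translation-free open normal anchor `M` with `ιX(Π^tp_Ÿ̲̲) ⊆ φ⁻¹(M)`, every nested root datum `(Rl, Rt)`
over the theta function `Θ̈` (`Rl` INHABITED by Prop. 4.2 (iii), p512762) and every constants datum, THERE IS a §5 datum `𝔉` over the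
small-index tower model whose `Π^tp_X` is the Setting's `Π^tp_X̲̲`-datum group `(C.thetaEnvData μ hC hS).PiX` (its `Θ̈` is the theta
function `thetaProperUnitQuot`, `firstDatumSmall_thetaFn`), whose `(l·Δ_Θ)_{(-)}` is the model's `Θ̈`-coordinate stub, satisfying `StrvSection ∧ SgpCapSpec ∧ SgpCupSpec ∧ SgpCapSection ∧
AutAmpleBN`** (`ιX := refl` is admissible: `(C.thetaEnvData μ hC hS).PiX = C.Huu = (C.temperedArithmeticGroup e).Pi`, p504077 §4).
[cite: MochizukiEtTh2009, §5 p.330–331 (PDF pp.104–105)] -/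
theorem exists_thetaFrobenioid_ofThetaSetting :
    ∃ 𝔉 : ThetaFrobenioid.{0} (settingSmall R S (C.temperedArithmeticGroup e) φ hφ (fun _ _ _ => True) M).C
        (ConnectedPart (BTemp (Compat 3 thetaShear))),
      𝔉.PiX = (C.thetaEnvData μ hC hS).PiX ∧
      (∀ E, 𝔉.lDelta E = (ThetaCoord.thetaStub (lv : ℕ)).lDelta E) ∧
      𝔉.StrvSection ∧ 𝔉.SgpCapSpec ∧ 𝔉.SgpCupSpec ∧ 𝔉.SgpCapSection ∧ 𝔉.AutAmpleBN :=
  ⟨firstDatumSmall R S (C.temperedArithmeticGroup e) φ hφ M hM (C.thetaEnvData μ hC hS) ιX hH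
      (ThetaCoord.thetaStub (lv : ℕ)) Rl Rt odd_l K' constEmb constEmb_injective,
    rfl, fun _ => rfl,
    laws_firstDatumSmall_ofThetaSetting_thetaStub R S C e μ hC hS φ hφ M hM ιX hH Rl Rt odd_l K' constEmb constEmb_injective⟩

/-- `ιX := refl` IS admissible at the genuine data: the §2 datum's `Π^tp_X` is the tempered arithmetic group's `Π` (both `C.Huu`,
definitionally; abc-iut-L2-t3 p504077 §4). [cite: MochizukiEtTh2009, §5 p.322 (PDF p.96)] -/
theorem thetaEnvData_PiX_eq_temperedArithmeticGroup_Pi : (C.thetaEnvData μ hC hS).PiX = (C.temperedArithmeticGroup e).Pi := rfl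

end OfThetaSetting

end ThetaTwistTowerSmallIndex

end Literature.AnabelianGeometry.EtaleTheta

end
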